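import Literature.AlgebraicGeometry.HodgeTheory.DiagonalCharacterEigenspace
import Literature.AlgebraicGeometry.Motives.HypersurfaceFormsNonsingular
import Mathlib.RingTheory.Polynomial.Cyclotomic.Basic
import HarnessLib

/-!
# Cyclic covers of projective space, Thom–Sebastiani sums, and deck-equivariant Hodge morphisms

Family `hodge`, layer `Literature/AlgebraicGeometry/HodgeTheory`. Vocabulary (definitions only, no
facts) for the *inductive structure* of Shioda–Katsura and for morphisms of Hodge structures between
the cohomologies of cyclic covers, on the real carriers `complexBetti`, `IsRationalClass`,
`IsOfHodgeType`, `diagonalPullback` of this layer.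

* `thomSebastianiForm f g = f(x) + g(y)` in disjoint sets of variables (the hypersurface
  `{f(x) + g(y) = 0} ⊂ ℙ^{a+b-1}` of "Fermat / Thom–Sebastiani type", Shioda–Katsura §1: it is
  dominated by the product of the cyclic covers `{f + w^d = 0}`, `{g + v^d = 0}` modulo the diagonal
  `μ_d`, whence `H_prim(X) ≅ [H_prim(S_f) ⊗ H_prim(S_g)]^{μ_d} ⊕ (curve part)`).
* `CyclicCover.form d f = f(x₀, …, x_{n+1}) + x_{n+2}^d`, the `d`-fold cyclic cover
  `S_f → ℙ^{n+1}` branched along `V(f)`, as a hypersurface of `ℙ^{n+2}`; `CyclicCover.surface d f`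
  the corresponding scheme `Motives.SmoothHypersurface.hypersurface`; `CyclicCover.IsDeck a` singles
  out the deck transformations `a = (1, …, 1, ζ)` inside the diagonal stabiliser, so that
  `diagonalPullback (form d f) ha k` for deck `a` is the action `σ^*` of the covering group `μ_d`.
* `IsHodgeMorphism nY nX k φ`: a `ℂ`-linear map `Hᵏ(Y(ℂ); ℂ) → Hᵏ(X(ℂ); ℂ)` mapping rational classes
  to rational classes and classes of Hodge type `(i, j)` to classes of type `(i, j)` — the spelling
  of "morphism of rational Hodge structures" used for Hodge isometries of K3 surfaces in
  `Surfaces/K3Surface` (Buskin).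
* `IsSupportedOnOrder m T φ`: `φ` kills the image of `Φ_m(T)` (`Φ_m` the `m`-th cyclotomic
  polynomial), i.e. for `T` of finite order `φ` factors through the projection onto the sum of the
  `T`-eigenspaces with eigenvalue a PRIMITIVE `m`-th root of unity (the isotypic component of
  "order exactly `m`"); `CyclicCover.IsSupportedOnDeckOrder` applies it to `T = σ^*` for a generator
  `σ` of the deck group.
* `CyclicCover.IsDeckEquivariant d f g k φ`: `φ ∘ σ_g^* = σ_f^* ∘ φ` for every deck transformation
  (the same `a = (1, …, 1, ζ)` acts on both covers).
* `CyclicCover.IsEigenGeneric d f k m`: every deck-equivariant Hodge endomorphism of `Hᵏ(S_f)` acts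
  on the order-`m` isotypic part as a polynomial in `σ^*` — i.e. the endomorphism algebra of the
  `ℚ(ζ_m)`-Hodge structure `H^{(m)}(S_f)` is `ℚ(ζ_m)` itself (the Hodge-generic situation for the
  eigenperiod maps of Deligne–Mostow / Allcock–Carlson–Toledo type).
* `linSubst M f = f ∘ M` and `IsProjEquiv f g` (`g = u · f ∘ M`, `M ∈ GL_N(ℂ)`, `u ≠ 0`): projective
  equivalence of forms, i.e. `V(f) ≅ V(g)` by a projectivity.

Consumers: summit routes on the Hodge conjecture for Thom–Sebastiani hypersurfaces
(`Summits/HodgeConjecture/…/Theses/SexticThomSebastianiEigenhom`), where the Hodge classes of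
`{f(x) + g(y) = 0}` become deck-equivariant Hodge morphisms `H²(S_g) → H²(S_f)` sorted by the order
of the eigenvalue of `σ^*`.

## References

* [ShiodaKatsura1979] T. Shioda, T. Katsura, On Fermat varieties, Tôhoku Math. J. 31 (1979), §1
  (the inductive structure `X^r_m × X^s_m ⇢ X^{r+s}_m`, Thm. 1 / (1.7)).
* [Shioda1979HodgeFermat] T. Shioda, The Hodge conjecture for Fermat varieties, Math. Ann. 245
  (1979), §1.
* [Buskin2019] N. Buskin, Every rational Hodge isometry between two K3 surfaces is algebraic,
  J. reine angew. Math. 755 (2019), §1 (morphisms of Hodge structures `T(S)_ℚ → T(S')_ℚ`).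
* [DeligneMostow1986] P. Deligne, G. D. Mostow, Monodromy of hypergeometric functions and
  non-lattice integral monodromy, Publ. Math. IHÉS 63 (1986), §2 (eigen-local-systems of cyclic covers).
* [AllcockCarlsonToledo2002] D. Allcock, J. Carlson, D. Toledo, The complex hyperbolic geometry of the
  moduli space of cubic surfaces, J. Algebraic Geom. 11 (2002), §2 (eigenperiods of cyclic covers,
  `σ^*`-eigenspaces `H_{ω}`, `H_{ω̄}`).
* [Katz2009] N. M. Katz, Another look at the Dwork family, §3 (eigendecomposition under a finite
  abelian group of diagonal symmetries).
* [SerreLinearRepresentations1977] J.-P. Serre, Linear Representations of Finite Groups, §2.6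
  (isotypic decomposition; for a cyclic group the projectors are polynomials in the generator).
-/

noncomputable section

open CategoryTheory

namespace Literature.AlgebraicGeometry.HodgeTheory

open MvPolynomial
open Literature.AlgebraicGeometry.Motives

universe u

/-! ### Forms: Thom–Sebastiani sums, linear substitutions, projective equivalence -/

section Forms

variable {R : Type u} [CommSemiring R]

/-- The **Thom–Sebastiani sum** `f(x₀,…,x_{a-1}) + g(y₀,…,y_{b-1})` of two forms in DISJOINT sets of
variables, as a polynomial in `a + b` variables (`x` first, then `y`): the equation of the
hypersurface of "Fermat type" `{f(x) + g(y) = 0} ⊂ ℙ^{a+b-1}` carrying Shioda–Katsura's inductive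
structure. [cite: ShiodaKatsura1979, §1] -/
def thomSebastianiForm {a b : ℕ} (f : MvPolynomial (Fin a) R) (g : MvPolynomial (Fin b) R) :
    MvPolynomial (Fin (a + b)) R :=
  rename (Fin.castAdd b) f + rename (Fin.natAdd a) g

/-- The linear substitution `f ↦ f ∘ M`, `(f ∘ M)(x) = f(M x)`: substitute `xᵢ ↦ Σⱼ Mᵢⱼ xⱼ`.
[folklore] -/
def linSubst {N : ℕ} (M : Matrix (Fin N) (Fin N) R) (f : MvPolynomial (Fin N) R) :
    MvPolynomial (Fin N) R :=
  aeval (fun i : Fin N => ∑ j : Fin N, C (M i j) * X j) f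

/-- **Projective equivalence of forms**: `g = u · (f ∘ M)` for an invertible matrix `M` and a unit
scalar `u`, i.e. the hypersurfaces `V(f)`, `V(g)` correspond under the projectivity `[x] ↦ [M x]`.
[folklore] -/
def IsProjEquiv {N : ℕ} {K : Type u} [Field K] (f g : MvPolynomial (Fin N) K) : Prop :=
  ∃ (M : Matrix (Fin N) (Fin N) K) (u : K), IsUnit M.det ∧ u ≠ 0 ∧ g = u • linSubst M f

end Forms

/-! ### Hodge morphisms between Betti cohomologies and isotypic support -/

/-- A `ℂ`-linear map `φ : Hᵏ(Y(ℂ); ℂ) → Hᵏ(X(ℂ); ℂ)` **is a morphism of rational Hodge structures**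
(`Y` of dimension `nY`, `X` of dimension `nX`): it maps rational classes to rational classes and
classes of Hodge type `(i, j)` to classes of Hodge type `(i, j)`, for all `(i, j)`. This is the
spelling used for Hodge isometries `T(S)_ℚ → T(S')_ℚ` of K3 surfaces (`Surfaces/K3Surface`,
`Buskin2019_hodgeIsometry_algebraic`), minus the isometry clause. [cite: Buskin2019, §1] -/
def IsHodgeMorphism {Y X : SchemeOver ℂ} (nY nX k : ℕ)
    (φ : complexBetti Y k →ₗ[ℂ] complexBetti X k) : Prop :=
  (∀ y : complexBetti Y k, IsRationalClass y → IsRationalClass (φ y)) ∧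
    ∀ (i j : ℕ) (y : complexBetti Y k), IsOfHodgeType nY Y k i j y → IsOfHodgeType nX X k i j (φ y)

/-- `φ` **is supported on the order-`m` isotypic part of `T`**: `φ ∘ Φ_m(T) = 0`, `Φ_m` the `m`-th
cyclotomic polynomial. For `T` of finite order `d` and `m ∣ d`, `ker Φ_m(T)` is the sum of the
eigenspaces of `T` whose eigenvalue is a primitive `m`-th root of unity and `range Φ_m(T)` is the sum
of the others, so the condition says that `φ` vanishes on every eigenspace of order `≠ m` — `φ`
factors through the isotypic projector onto "order exactly `m`" (a polynomial in `T`).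
[cite: SerreLinearRepresentations1977, §2.6 Thm. 8] -/
def IsSupportedOnOrder {V W : Type*} [AddCommGroup V] [Module ℂ V] [AddCommGroup W] [Module ℂ W]
    (m : ℕ) (T : Module.End ℂ V) (φ : V →ₗ[ℂ] W) : Prop :=
  φ ∘ₗ Polynomial.aeval T (Polynomial.cyclotomic m ℂ) = 0

/-! ### Cyclic covers `S_f = {f + x_{n+2}^d = 0}` and their deck group -/

namespace CyclicCover

variable {n : ℕ}

/-- The **cyclic cover form** `f(x₀, …, x_{n+1}) + x_{n+2}^d` in `n + 3` variables: its zero locus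
`S_f ⊂ ℙ^{n+2}` is the `d`-fold cyclic cover of `ℙ^{n+1}` branched along `V(f)` (for `f` of degree
`d`), the building block of the inductive structure (`X¹ : F₁(x) = x₃^d` in Shioda–Katsura; the
cyclic-cover trick of Allcock–Carlson–Toledo). [cite: ShiodaKatsura1979, §1] -/
def form (d : ℕ) (f : MvPolynomial (Fin (n + 2)) ℂ) : MvPolynomial (Fin (n + 1 + 2)) ℂ :=
  rename Fin.castSucc f + X (Fin.last (n + 2)) ^ d

/-- The cyclic cover `S_f = V₊(f + x_{n+2}^d) ⊂ ℙ^{n+2}_ℂ` as a `ℂ`-scheme (reduced induced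
structure, `Motives.SmoothHypersurface.hypersurface`). [cite: ShiodaKatsura1979, §1] -/
abbrev surface (d : ℕ) (f : MvPolynomial (Fin (n + 2)) ℂ) : SchemeOver ℂ :=
  SmoothHypersurface.hypersurface (form d f)

/-- `a ∈ (ℂˣ)^{n+3}` **is a deck scaling**: it is trivial on the first `n + 2` coordinates, i.e.
`a = (1, …, 1, ζ)`; for such `a` in the diagonal stabiliser of `form d f` (which means `ζ^d = 1` as
soon as `f ≠ 0`) the automorphism `g_a` of `S_f` is the deck transformation `x_{n+2} ↦ ζ x_{n+2}` of
`S_f → ℙ^{n+1}`, and `diagonalPullback (form d f) ha k = σ_ζ^*`.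
[cite: AllcockCarlsonToledo2002, §2] -/
def IsDeck (a : Fin (n + 1 + 2) → ℂˣ) : Prop :=
  ∀ i : Fin (n + 2), a (Fin.castSucc i) = 1

/-- `a` **generates the deck group**: a deck scaling whose last coordinate is a PRIMITIVE `d`-th
root of unity (so `g_a = σ` generates `μ_d` and `σ^*` has order dividing `d` on cohomology).
[cite: AllcockCarlsonToledo2002, §2] -/
def IsDeckGenerator (d : ℕ) (a : Fin (n + 1 + 2) → ℂˣ) : Prop :=
  IsDeck a ∧ IsPrimitiveRoot (a (Fin.last (n + 2))) d

/-- A linear map `φ : Hᵏ(S_g) → Hᵏ(S_f)` between the cohomologies of two `d`-cyclic covers **is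
deck-equivariant**: `φ ∘ σ_g^* = σ_f^* ∘ φ` for every deck scaling `a = (1, …, 1, ζ)` stabilising
both cover forms (the same `ζ` acting on both covers — the diagonal `μ_d` of the inductive
structure). [cite: ShiodaKatsura1979, §1] -/
def IsDeckEquivariant (d : ℕ) (f g : MvPolynomial (Fin (n + 2)) ℂ) (k : ℕ)
    (φ : complexBetti (surface d g) k →ₗ[ℂ] complexBetti (surface d f) k) : Prop :=
  ∀ (a : Fin (n + 1 + 2) → ℂˣ) (haf : a ∈ diagonalStabilizer (form d f))
    (hag : a ∈ diagonalStabilizer (form d g)), IsDeck a →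
    φ ∘ₗ diagonalPullback (form d g) hag k = diagonalPullback (form d f) haf k ∘ₗ φ

/-- A linear map out of `Hᵏ(S_g)` **is supported on the order-`m` part of the deck action**:
`φ ∘ Φ_m(σ^*) = 0` for every generator `σ` of the deck group of `S_g` (`IsSupportedOnOrder` with
`T = σ^*`); e.g. for `d = 6`: `m = 1` the invariant part, `m = 2` the `(-1)`-eigenspace (pulled back
from the intermediate double cover), `m = 3`, `m = 6` the pairs of conjugate primitive eigenspaces.
[cite: SerreLinearRepresentations1977, §2.6 Thm. 8] -/
def IsSupportedOnDeckOrder (d : ℕ) (g : MvPolynomial (Fin (n + 2)) ℂ) (k m : ℕ)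
    {W : Type*} [AddCommGroup W] [Module ℂ W] (φ : complexBetti (surface d g) k →ₗ[ℂ] W) : Prop :=
  ∀ (a : Fin (n + 1 + 2) → ℂˣ) (hag : a ∈ diagonalStabilizer (form d g)), IsDeckGenerator d a →
    IsSupportedOnOrder m (diagonalPullback (form d g) hag k) φ

/-- `S_f` **is eigen-generic in order `m`** (degree `k`): every deck-equivariant Hodge endomorphism
`ψ` of `Hᵏ(S_f(ℂ); ℂ)` agrees on the order-`m` isotypic part `ker Φ_m(σ^*)` with a polynomial in
`σ^*` — equivalently the endomorphism algebra of the `ℚ(ζ_m)`-Hodge structure `H^{(m)}(S_f)` is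
reduced to `ℚ(ζ_m)` (no extra endomorphisms: the Hodge-generic case for the order-`m` eigenperiod
map). The polynomial may depend on the chosen generator. [cite: DeligneMostow1986, §2] -/
def IsEigenGeneric (d : ℕ) (f : MvPolynomial (Fin (n + 2)) ℂ) (k m : ℕ) : Prop :=
  ∀ ψ : complexBetti (surface d f) k →ₗ[ℂ] complexBetti (surface d f) k,
    IsHodgeMorphism (n + 1) (n + 1) k ψ → IsDeckEquivariant d f f k ψ →
    ∀ (a : Fin (n + 1 + 2) → ℂˣ) (ha : a ∈ diagonalStabilizer (form d f)), IsDeckGenerator d a →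
      ∃ q : Polynomial ℂ, ∀ x : complexBetti (surface d f) k,
        Polynomial.aeval (diagonalPullback (form d f) ha k) (Polynomial.cyclotomic m ℂ) x = 0 →
          ψ x = Polynomial.aeval (diagonalPullback (form d f) ha k) q x

end CyclicCover

end Literature.AlgebraicGeometry.HodgeTheory
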